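import Mathlib.RepresentationTheory.Character
import Mathlib.RepresentationTheory.Maschke
import Mathlib.RepresentationTheory.Irreducible
import Mathlib.LinearAlgebra.Trace
import Mathlib.LinearAlgebra.Projection
import Mathlib.LinearAlgebra.Dimension.Free
import Mathlib.Algebra.CharP.Invertible
import HarnessLib

/-!
# A representation of a finite group in characteristic zero is determined by its character

Topic `Literature/RepresentationTheory/FiniteGroups`.  Serre, *Linear Representations of
Finite Groups*, §2.3, Corollary 2 to Theorem 4: "Two representations with the same character
are isomorphic" (for finite groups over `ℂ`; the proof — complete reducibility, Thm. 2, and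
the orthogonality relations, Thm. 3–4 — works verbatim over any field of characteristic
zero).  Neukirch, *Algebraic Number Theory*, VII §10, p. 522, uses it to write Artin L-series
as functions `𝓛(L|K, χ, s)` of the character.  This is the representation-theoretic input of
the named fact `Literature.NumberTheory.GaloisRepresentations.artinLFunction_eq_of_character_eq`
(`Literature.NumberTheory.GaloisRepresentations.ArtinFormalism`).

Main result (**proved**): `Literature.RepresentationTheory.FiniteGroups.Representation.nonempty_equiv_of_character_eq` — for a finite
group `G`, a field `k` of characteristic zero and finite-dimensional representations `ρ`, `σ`
of `G` over `k` with `ρ.character = σ.character`, there is an equivalence `ρ ≃ σ`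
(Mathlib `Representation.Equiv`).

Proof (induction on `dim V`, avoiding the classification of irreducibles): if `V ≠ 0` pick a
subrepresentation `S ⊆ V` of minimal positive dimension, which is irreducible
(`isIrreducible_of_finrank_minimal`); by Mathlib's
`card_inv_mul_sum_char_mul_char_eq_finrank` (`⟨χ_W, χ_S⟩ = dim Hom_G(S, W)`) and `χ_V = χ_W`,
`dim Hom_G(S, W) = dim Hom_G(S, V) ≥ 1`, so there is a non-zero, hence injective (Schur,
`injective_or_eq_zero`), `G`-map `S → W` with image `S' ≅ S`; Maschke
(`IsSemisimpleRepresentation`) gives complements `V = S ⊕ V₁`, `W = S' ⊕ W₁`, additivity of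
characters (`character_eq_add_of_isCompl`) gives `χ_{V₁} = χ_{W₁}`, and induction applies.

Also proved, as API: `Representation.char_prod` (`χ_{ρ ⊕ σ} = χ_ρ + χ_σ`),
`Representation.Equiv.prodCongr`, `Subrepresentation.prodEquivOfIsCompl`
(`ρ|_p ⊕ ρ|_q ≃ ρ` for complementary subrepresentations), `Subrepresentation.equivRange`
(an injective `G`-map is an equivalence onto its range),
`exists_ne_bot_isIrreducible` (a non-zero finite-dimensional representation has an
irreducible subrepresentation).

## Mathlib search

Mathlib (this pin) has `Representation.character`, `char_iso`, `char_one`,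
`card_inv_mul_sum_char_mul_char_eq_finrank`, `char_orthonormal`
(`RepresentationTheory/Character.lean`), `Representation.IsIrreducible` with
`injective_or_eq_zero` (`Irreducible.lean`), `Subrepresentation`, `IntertwiningMap`,
`Representation.Equiv` (`Intertwining.lean`), Maschke's theorem as the instance
`IsSemisimpleRepresentation ρ` (`Maschke.lean`), `Representation.prod`,
`LinearMap.trace_prodMap'`, but not the statement that the character determines the
representation (grep `char_iso`, `character` in `RepresentationTheory`: only the converse
`char_iso`).  Declarations are named `Literature.Representation.*` / `Literature.Subrepresentation.*`
after the Mathlib structures they concern, but live in the `Literature` namespace (nothing is added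
to Mathlib's own namespaces), so callers use the full names (`Representation.Equiv.prodCongr
e₁ e₂` with `Literature` open), not dot notation.  In characteristic zero `#G` is invertible in `k`
by Mathlib's `invertibleOfPos` (`Algebra/CharP/Invertible.lean`, from `NeZero (Nat.card G)`),
which feeds `card_inv_mul_sum_char_mul_char_eq_finrank`.

## References

* J.-P. Serre, *Linear Representations of Finite Groups*, GTM 42 (1977), §1.3–1.4
  (subrepresentations, complete reducibility), §2.3 Thm. 4 and Cor. 2
  (`SerreLinearRepresentations1977`).
* J. Neukirch, *Algebraic Number Theory* (1999), VII §10, p. 520–522 (`NeukirchANT1999`).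
-/

noncomputable section

open Module

namespace Literature.RepresentationTheory.FiniteGroups

universe u v w w'

variable {k : Type u} {G : Type v} [Field k] [Group G]

/-! ### Direct sums -/

section Prod

variable {V : Type w} {W : Type w'} [AddCommGroup V] [Module k V] [AddCommGroup W] [Module k W]

/-- **The character of a direct sum is the sum of the characters**: `χ_{ρ ⊕ σ} = χ_ρ + χ_σ`
(Mathlib `Representation.prod`, `LinearMap.trace_prodMap'`).
Ref: Serre, *Linear Representations*, §2.1, Prop. 2 (i). [cite: SerreLinearRepresentations1977, §2.1 Prop. 2] -/
theorem Representation.char_prod [FiniteDimensional k V] [FiniteDimensional k W]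
    (ρ : Representation k G V) (σ : Representation k G W) :
    (ρ.prod σ).character = ρ.character + σ.character := by
  funext g
  simp only [Representation.character, Pi.add_apply]
  exact LinearMap.trace_prodMap' _ _

/-- Equivariance of an equivalence of representations, pointwise. [folklore] -/
theorem Representation.Equiv.apply_apply {ρ : Representation k G V} {σ : Representation k G W}
    (e : ρ.Equiv σ) (g : G) (v : V) : e (ρ g v) = σ g (e v) :=
  Representation.IntertwiningMap.isIntertwining _ _ e.toIntertwiningMap g v

variable {V' : Type*} {W' : Type*} [AddCommGroup V'] [Module k V'] [AddCommGroup W'] [Module k W']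

/-- Equivalences of the summands give an equivalence of direct sums
(Mathlib `LinearEquiv.prodCongr`). Ref: Serre, *Linear Representations*, §1.3. [folklore] -/
def Representation.Equiv.prodCongr {ρ : Representation k G V} {ρ' : Representation k G V'}
    {σ : Representation k G W} {σ' : Representation k G W'} (e₁ : ρ.Equiv ρ') (e₂ : σ.Equiv σ') :
    (ρ.prod σ).Equiv (ρ'.prod σ') :=
  Representation.Equiv.mk (e₁.toLinearEquiv.prodCongr e₂.toLinearEquiv) fun g => by
    refine LinearMap.ext fun v => ?_
    simp only [LinearMap.coe_comp, LinearEquiv.coe_coe, Function.comp_apply,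
      Representation.prod_apply_apply, LinearEquiv.prodCongr_apply,
      Representation.Equiv.toLinearEquiv_apply]
    exact Prod.ext (Representation.Equiv.apply_apply e₁ g v.1) (Representation.Equiv.apply_apply e₂ g v.2)

end Prod

/-! ### Subrepresentations: complements, ranges, irreducible pieces -/

section Subrep

variable {V : Type w} {W : Type w'} [AddCommGroup V] [Module k V] [AddCommGroup W] [Module k W]
  (ρ : Representation k G V)

/-- Unfolding lemma: a subrepresentation acts by restriction. [folklore] -/
@[simp] theorem Subrepresentation.toRepresentation_apply_coe (p : Subrepresentation ρ) (g : G)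
    (v : p.toSubmodule) : (p.toRepresentation g v : V) = ρ g v := rfl

/-- Complementary subrepresentations have complementary underlying submodules. [folklore] -/
theorem Subrepresentation.isCompl_toSubmodule {p q : Subrepresentation ρ} (h : IsCompl p q) :
    IsCompl p.toSubmodule q.toSubmodule := by
  refine ⟨?_, ?_⟩
  · rw [disjoint_iff]
    have h' := disjoint_iff.mp h.disjoint
    exact congrArg Subrepresentation.toSubmodule h'
  · rw [codisjoint_iff]
    have h' := codisjoint_iff.mp h.codisjoint
    exact congrArg Subrepresentation.toSubmodule h'

/-- **Complete reducibility, one step**: for complementary subrepresentations `p`, `q` of `ρ`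
the sum map `ρ|_p ⊕ ρ|_q ≃ ρ`, `(x, y) ↦ x + y` (Mathlib `Submodule.prodEquivOfIsCompl`), is
an equivalence of representations.
Ref: Serre, *Linear Representations*, §1.3 (direct sums) and §1.4 Thm. 1. [cite: SerreLinearRepresentations1977, §1.4 Thm. 1] -/
def Subrepresentation.prodEquivOfIsCompl (p q : Subrepresentation ρ) (h : IsCompl p q) :
    (p.toRepresentation.prod q.toRepresentation).Equiv ρ :=
  Representation.Equiv.mk
    (Submodule.prodEquivOfIsCompl _ _ (Subrepresentation.isCompl_toSubmodule ρ h)) fun g => by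
    refine LinearMap.ext fun v => ?_
    simp only [LinearMap.coe_comp, LinearEquiv.coe_coe, Function.comp_apply,
      Representation.prod_apply_apply, Submodule.coe_prodEquivOfIsCompl',
      Subrepresentation.toRepresentation_apply_coe, map_add]

/-- **Additivity of the character in a direct decomposition**: if `V = p ⊕ q` with
subrepresentations `p`, `q`, then `χ_ρ = χ_{ρ|p} + χ_{ρ|q}`.
Ref: Serre, *Linear Representations*, §2.1 Prop. 2 (i). [cite: SerreLinearRepresentations1977, §2.1 Prop. 2] -/
theorem Representation.character_eq_add_of_isCompl [FiniteDimensional k V]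
    (p q : Subrepresentation ρ) (h : IsCompl p q) :
    ρ.character = p.toRepresentation.character + q.toRepresentation.character := by
  rw [← Representation.char_iso (Subrepresentation.prodEquivOfIsCompl ρ p q h),
    Representation.char_prod]

variable {ρ} {σ : Representation k G W}

/-- An injective `G`-map is an equivalence onto its range (a subrepresentation,
Mathlib `IntertwiningMap.range`; `LinearEquiv.ofInjective`).
Ref: Serre, *Linear Representations*, §2.2 (Schur's lemma, proof). [folklore] -/
def Subrepresentation.equivRange (f : Representation.IntertwiningMap ρ σ)
    (hf : Function.Injective f) : ρ.Equiv f.range.toRepresentation :=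
  Representation.Equiv.mk (LinearEquiv.ofInjective f.toLinearMap hf) fun g => by
    refine LinearMap.ext fun v => Subtype.ext ?_
    simp only [LinearMap.coe_comp, LinearEquiv.coe_coe, Function.comp_apply,
      Subrepresentation.toRepresentation_apply_coe]
    exact Representation.IntertwiningMap.isIntertwining _ _ f g v

/-- The inclusion of a subrepresentation, as a `G`-map. [folklore] -/
def Subrepresentation.subtypeIntertwiningMap (p : Subrepresentation ρ) :
    Representation.IntertwiningMap p.toRepresentation ρ where
  toLinearMap := p.toSubmodule.subtype
  isIntertwining' _ := rfl

/-- The inclusion of a non-zero subrepresentation is a non-zero `G`-map. [folklore] -/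
theorem Subrepresentation.subtypeIntertwiningMap_ne_zero {p : Subrepresentation ρ} (hp : p ≠ ⊥) :
    Subrepresentation.subtypeIntertwiningMap p ≠ 0 := by
  intro h
  apply hp
  apply Subrepresentation.toSubmodule_injective
  change p.toSubmodule = ⊥
  rw [eq_bot_iff]
  intro v hv
  have : (Subrepresentation.subtypeIntertwiningMap p : p.toSubmodule → V) ⟨v, hv⟩ = 0 := by rw [h]; rfl
  exact this

/-- The image in `ρ` of a subrepresentation of `ρ|_p` (push-forward along the inclusion). [folklore] -/
def Subrepresentation.mapSubtype (p : Subrepresentation ρ)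
    (q : Subrepresentation p.toRepresentation) : Subrepresentation ρ where
  toSubmodule := q.toSubmodule.map p.toSubmodule.subtype
  apply_mem_toSubmodule g v hv := by
    obtain ⟨w, hw, rfl⟩ := hv
    exact ⟨p.toRepresentation g w, q.apply_mem_toSubmodule g hw, rfl⟩

/-- **A non-zero subrepresentation of minimal dimension is irreducible.**
Ref: Serre, *Linear Representations*, §1.4 (proof of Thm. 2: induction on the dimension). [folklore] -/
theorem Subrepresentation.isIrreducible_of_finrank_minimal [FiniteDimensional k V]
    (p : Subrepresentation ρ) (hp : p ≠ ⊥)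
    (hmin : ∀ q : Subrepresentation ρ, q ≠ ⊥ → finrank k p.toSubmodule ≤ finrank k q.toSubmodule) :
    p.toRepresentation.IsIrreducible := by
  haveI : Nontrivial (Subrepresentation p.toRepresentation) := by
    refine ⟨⟨⊥, ⊤, fun h => hp ?_⟩⟩
    apply Subrepresentation.toSubmodule_injective
    change p.toSubmodule = ⊥
    have h' : (⊥ : Submodule k p.toSubmodule) = ⊤ := congrArg Subrepresentation.toSubmodule h
    rw [eq_bot_iff]
    intro v hv
    have hmem : (⟨v, hv⟩ : p.toSubmodule) ∈ (⊥ : Submodule k p.toSubmodule) := by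
      rw [h']; exact Submodule.mem_top
    rw [Submodule.mem_bot] at hmem ⊢
    exact congrArg Subtype.val hmem
  refine ⟨fun q => ?_⟩
  by_cases hq : q = ⊥
  · exact Or.inl hq
  · right
    have hq' : Subrepresentation.mapSubtype p q ≠ ⊥ := by
      intro h
      apply hq
      apply Subrepresentation.toSubmodule_injective
      change q.toSubmodule = ⊥
      have h' : q.toSubmodule.map p.toSubmodule.subtype = ⊥ := congrArg Subrepresentation.toSubmodule h
      exact Submodule.map_injective_of_injective p.toSubmodule.injective_subtype
        (h'.trans (Submodule.map_bot _).symm)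
    have h1 := hmin _ hq'
    change finrank k p.toSubmodule ≤ finrank k (q.toSubmodule.map p.toSubmodule.subtype) at h1
    rw [Submodule.finrank_map_subtype_eq] at h1
    have h2 : finrank k q.toSubmodule ≤ finrank k p.toSubmodule := Submodule.finrank_le _
    apply Subrepresentation.toSubmodule_injective
    change q.toSubmodule = ⊤
    exact Submodule.eq_top_of_finrank_eq (le_antisymm h2 h1)

variable (ρ) in
/-- **A non-zero finite-dimensional representation has an irreducible subrepresentation**
(take a non-zero one of minimal dimension).
Ref: Serre, *Linear Representations*, §1.4 Thm. 2 (proof). [cite: SerreLinearRepresentations1977, §1.4 Thm. 2] -/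
theorem Representation.exists_ne_bot_isIrreducible [FiniteDimensional k V] [Nontrivial V] :
    ∃ p : Subrepresentation ρ, p ≠ ⊥ ∧ p.toRepresentation.IsIrreducible := by
  classical
  have htop : (⊤ : Subrepresentation ρ) ≠ ⊥ := by
    intro h
    have h' : (⊤ : Submodule k V) = ⊥ := congrArg Subrepresentation.toSubmodule h
    exact bot_ne_top h'.symm
  have hne : ∃ n, ∃ p : Subrepresentation ρ, p ≠ ⊥ ∧ finrank k p.toSubmodule = n :=
    ⟨_, ⊤, htop, rfl⟩
  obtain ⟨p, hp, hpn⟩ := Nat.find_spec hne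
  refine ⟨p, hp, Subrepresentation.isIrreducible_of_finrank_minimal p hp fun q hq => ?_⟩
  rw [hpn]
  exact Nat.find_min' hne ⟨q, hq, rfl⟩

end Subrep

/-! ### The character determines the representation -/

section Main

variable [Fintype G] [CharZero k]

/-- **Equal characters force a non-zero `G`-map out of every non-zero subrepresentation**:
if `χ_ρ = χ_σ` and `p ≠ 0` is a subrepresentation of `ρ`, then `Hom_G(ρ|_p, σ) ≠ 0`, because
`dim Hom_G(p, σ) = ⟨χ_σ, χ_p⟩ = ⟨χ_ρ, χ_p⟩ = dim Hom_G(p, ρ) ≥ 1`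
(Mathlib `card_inv_mul_sum_char_mul_char_eq_finrank`).
Ref: Serre, *Linear Representations*, §2.3 Thm. 4 and Cor. 2 (proof). [cite: SerreLinearRepresentations1977, §2.3 Thm. 4] -/
theorem Representation.exists_intertwiningMap_ne_zero_of_character_eq
    {V : Type w} {W : Type w'} [AddCommGroup V] [Module k V] [FiniteDimensional k V]
    [AddCommGroup W] [Module k W] [FiniteDimensional k W]
    {ρ : Representation k G V} {σ : Representation k G W} (h : ρ.character = σ.character)
    {p : Subrepresentation ρ} (hp : p ≠ ⊥) :
    ∃ f : Representation.IntertwiningMap p.toRepresentation σ, f ≠ 0 := by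
  have h1 := Representation.card_inv_mul_sum_char_mul_char_eq_finrank p.toRepresentation σ
  have h2 := Representation.card_inv_mul_sum_char_mul_char_eq_finrank p.toRepresentation ρ
  rw [h, h1] at h2
  have h3 : finrank k (Representation.IntertwiningMap p.toRepresentation σ) =
      finrank k (Representation.IntertwiningMap p.toRepresentation ρ) := by exact_mod_cast h2
  have h4 : 0 < finrank k (Representation.IntertwiningMap p.toRepresentation ρ) :=
    Module.finrank_pos_iff_exists_ne_zero.mpr
      ⟨Subrepresentation.subtypeIntertwiningMap p, Subrepresentation.subtypeIntertwiningMap_ne_zero hp⟩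
  rw [← h3] at h4
  exact Module.finrank_pos_iff_exists_ne_zero.mp h4

omit [Fintype G] in
/-- Representations of dimension `0` with equal characters (i.e. both of dimension `0`) are
equivalent. [folklore] -/
theorem Representation.nonempty_equiv_of_finrank_eq_zero
    {V : Type w} {W : Type w'} [AddCommGroup V] [Module k V] [FiniteDimensional k V]
    [AddCommGroup W] [Module k W] [FiniteDimensional k W]
    (ρ : Representation k G V) (σ : Representation k G W) (h : ρ.character = σ.character)
    (hV : finrank k V = 0) : Nonempty (ρ.Equiv σ) := by
  have hW : finrank k W = 0 := by
    have h1 := congrFun h 1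
    rw [Representation.char_one, Representation.char_one, hV] at h1
    exact_mod_cast h1.symm
  haveI : Subsingleton W := Module.finrank_zero_iff.mp hW
  exact ⟨Representation.Equiv.mk (LinearEquiv.ofFinrankEq V W (hV.trans hW.symm)) fun g =>
    LinearMap.ext fun v => Subsingleton.elim _ _⟩

/-- Induction step carrier for `nonempty_equiv_of_character_eq` (induction on the dimension,
both spaces varying). [folklore] -/
theorem Representation.nonempty_equiv_of_character_eq_aux (n : ℕ) :
    ∀ {V : Type w} {W : Type w'} [AddCommGroup V] [Module k V] [FiniteDimensional k V]
      [AddCommGroup W] [Module k W] [FiniteDimensional k W]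
      (ρ : Representation k G V) (σ : Representation k G W),
      finrank k V ≤ n → ρ.character = σ.character → Nonempty (ρ.Equiv σ) := by
  induction n with
  | zero =>
    intro V W _ _ _ _ _ _ ρ σ hV h
    exact Representation.nonempty_equiv_of_finrank_eq_zero ρ σ h (Nat.le_zero.mp hV)
  | succ n ih =>
    intro V W _ _ _ _ _ _ ρ σ hV h
    rcases subsingleton_or_nontrivial V with hV0 | hV0
    · exact Representation.nonempty_equiv_of_finrank_eq_zero ρ σ h Module.finrank_zero_of_subsingleton
    -- an irreducible piece `p` of `ρ` and a non-zero, hence injective, `G`-map `p → σ`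
    obtain ⟨p, hp, hirr⟩ := Representation.exists_ne_bot_isIrreducible ρ
    obtain ⟨f, hf⟩ := Representation.exists_intertwiningMap_ne_zero_of_character_eq h hp
    haveI := hirr
    have hfinj : Function.Injective f :=
      (Representation.IsIrreducible.injective_or_eq_zero f).resolve_right hf
    let e₁ := Subrepresentation.equivRange f hfinj
    -- complements (Maschke)
    obtain ⟨q, hq⟩ := exists_isCompl p
    obtain ⟨q', hq'⟩ := exists_isCompl f.range
    -- characters of the complements agree
    have hc : q.toRepresentation.character = q'.toRepresentation.character := by
      have h1 := Representation.character_eq_add_of_isCompl ρ p q hq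
      have h2 := Representation.character_eq_add_of_isCompl σ f.range q' hq'
      rw [h, Representation.char_iso e₁] at h1
      exact add_left_cancel (h1.symm.trans h2)
    -- dimension drops
    have hdim : finrank k q.toSubmodule ≤ n := by
      have h1 := Submodule.finrank_add_eq_of_isCompl (Subrepresentation.isCompl_toSubmodule ρ hq)
      have h2 : 0 < finrank k p.toSubmodule := by
        rw [Module.finrank_pos_iff]
        by_contra hnt
        apply hp
        apply Subrepresentation.toSubmodule_injective
        change p.toSubmodule = ⊥
        rw [not_nontrivial_iff_subsingleton] at hnt
        exact Submodule.eq_bot_of_subsingleton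
      omega
    obtain ⟨e₂⟩ := ih q.toRepresentation q'.toRepresentation hdim hc
    exact ⟨((Subrepresentation.prodEquivOfIsCompl ρ p q hq).symm.trans
      (Representation.Equiv.prodCongr e₁ e₂)).trans
        (Subrepresentation.prodEquivOfIsCompl σ f.range q' hq')⟩

/-- **A representation of a finite group in characteristic zero is determined by its
character** (Serre, *Linear Representations of Finite Groups*, §2.3, Cor. 2 to Thm. 4: "two
representations with the same character are isomorphic"; Neukirch VII §10, p. 522).  For a
finite group `G`, a field `k` with `char k = 0`, and representations `ρ`, `σ` of `G` on
finite-dimensional `k`-spaces `V`, `W` with `ρ.character = σ.character`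
(`Representation.character g = tr ρ(g)`), there is an equivalence of representations
`ρ ≃ σ` (Mathlib `Representation.Equiv`).  (The converse is Mathlib's `char_iso`.)
[cite: SerreLinearRepresentations1977, §2.3 Cor. 2] [cite: NeukirchANT1999, VII §10, p. 522] -/
theorem Representation.nonempty_equiv_of_character_eq
    {V : Type w} {W : Type w'} [AddCommGroup V] [Module k V] [FiniteDimensional k V]
    [AddCommGroup W] [Module k W] [FiniteDimensional k W]
    (ρ : Representation k G V) (σ : Representation k G W) (h : ρ.character = σ.character) :
    Nonempty (ρ.Equiv σ) :=
  Representation.nonempty_equiv_of_character_eq_aux (finrank k V) ρ σ le_rfl h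

/-- The character criterion for equivalence: `ρ ≃ σ ↔ χ_ρ = χ_σ`.
Ref: Serre, *Linear Representations*, §2.3 Cor. 2. [cite: SerreLinearRepresentations1977, §2.3 Cor. 2] -/
theorem Representation.nonempty_equiv_iff_character_eq
    {V : Type w} {W : Type w'} [AddCommGroup V] [Module k V] [FiniteDimensional k V]
    [AddCommGroup W] [Module k W] [FiniteDimensional k W]
    (ρ : Representation k G V) (σ : Representation k G W) :
    Nonempty (ρ.Equiv σ) ↔ ρ.character = σ.character :=
  ⟨fun ⟨e⟩ => Representation.char_iso e, Representation.nonempty_equiv_of_character_eq ρ σ⟩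

end Main

end Literature.RepresentationTheory.FiniteGroups
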